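import Literature.Topology.FourManifolds.ClosedModelRelOrientation
import Literature.AlgebraicTopology.SingularHomology.RelFundamentalClassModTwo
import Literature.AlgebraicTopology.SingularHomology.UniversalCoefficientsField
import Literature.AlgebraicTopology.SingularHomology.CellsAttachmentEuler
import Mathlib.LinearAlgebra.FiniteDimensional.Basic
import HarnessLib

/-!
# The top `ℤ/2`-(co)homology of the closed model `W ∪ cone(∂W)` is `ℤ/2` — without an atlas on it

Topic `Literature/Topology/FourManifolds`; a proofs file of the fact seat of
`Literature.Topology.FourManifolds.HomotopySphere.exists_mem_signatureSet_iff_eight_dvd`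
(M. Kervaire, J. Milnor, *Groups of homotopy spheres I*, Ann. of Math. 77 (1963), §7, p. 530:
"a given integer `σ` occurs as `σ(M)` for some s-parallelizable `M` bounded by a homotopy sphere
if and only if `σ ≡ 0 (modulo 8)`"). Everything here is **proved**; no definition of a notion, no
named fact (D-0026).

## Why

The divisibility half `8 ∣ σ(M)` is reduced in the tree
(`HomotopySphere.eight_dvd_of_mem_signatureSet_of_isEven`,
`HomotopySpheresBPOrderSignatureUnimodular.lean`) to the EVENNESS of the cup-product form of the
closed model `M̂ = M ∪ cone(bM)` of every s-parallelizable null-cobordism `M` of a homotopy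
`(4m-1)`-sphere (Kosinski, *Differential Manifolds* (1993), X.3.1; Kervaire–Milnor p. 528 with
the footnote pp. 528–529). The Wu-class proof of evenness (Milnor–Stasheff, *Characteristic
classes* (1974), §18 and Thm. 11.14: the Pontryagin–Thom collapse `g : Sⁿ⁺¹⁺ᴺ → Sᴺ M̂` of a tube
is nonzero on `Hⁿ⁺¹⁺ᴺ(-; ℤ/2)` and commutes with `Sq`, so `Sq²ᵐ : H²ᵐ(M̂; ℤ/2) → Hⁿ⁺¹(M̂; ℤ/2)`
vanishes) needs exactly one piece of information about the closed model in the top degree: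

  **`Hⁿ⁺¹(M̂; ℤ/2)` has a single nonzero element**, i.e. `dim_{ℤ/2} Hⁿ⁺¹(M̂; ℤ/2) = 1`.

For a closed topological manifold this is Hatcher's Thm. 3.26 (`H_{n+1}(M̂; ℤ/2) ≅ ℤ/2`), but
`M̂` is known to be a topological manifold only through the generalised Poincaré conjecture
(`HomotopySphere.nonempty_chartedSpace_closedModel`, Kosinski X.3.3 with VIII.4.6). This file
proves the statement for the closed model of EVERY compact connected smooth manifold `W` with
nonempty boundary, with no atlas on `M̂` and no hypothesis on `∂W` beyond compactness, from
three theorems of the tree: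

* Lefschetz duality modulo `2` for every compact manifold with boundary, in bidegree
  `(0, n + 1)`: `a ↦ a ⌢ [W, ∂W]₂ : H⁰(W; ℤ/2) ≅ Hₙ₊₁(W, ∂W; ℤ/2)`
  (`bijective_relCapProduct_relFundamentalClassModTwo`, `RelFundamentalClassModTwo.lean`;
  Spanier, *Algebraic Topology* (1981), 6.3.12; Hatcher Thm. 3.43, every manifold being
  `ℤ/2`-orientable, p. 235);
* Hatcher's Prop. 2.22 for the good pair `(W, ∂W)` and the exact sequence of the pair `(M̂, ∞)`:
  `Hₙ₊₁(W, ∂W; ℤ/2) ≅ Hₙ₊₁(M̂, ∞; ℤ/2) ≅ Hₙ₊₁(M̂; ℤ/2)`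
  (`NullCobordism.isIso_map_boundaryCollapse_succ`, `NullCobordism.isIso_ofAbsolute_infty_of_le`);
* universal coefficients over the field `ℤ/2` (`finrank_singularCohomology_eq_bettiNumber_of_field`,
  Hatcher Thm. 3.2 with p. 198) in degrees `0` (on `W`: `H⁰(W; ℤ/2) ≅ ℤ/2` for the path-connected
  `W`, Prop. 2.7) and `n + 1` (on `M̂`).

## Contents

* `NullCobordism.finrank_relativeSingularHomology_top_zmodTwo` — `dim Hₙ₊₁(W, ∂W; ℤ/2) = 1`;
* `NullCobordism.finrank_singularHomology_closedModel_top_zmodTwo` — `dim Hₙ₊₁(M̂; ℤ/2) = 1`;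
* `NullCobordism.finrank_singularCohomology_closedModel_top_zmodTwo` — `dim Hⁿ⁺¹(M̂; ℤ/2) = 1`;
* `NullCobordism.nonempty_singularHomology_closedModel_top_iso_zmodTwo` —
  `Hₙ₊₁(M̂; ℤ/2) ≅ ℤ/2` as `ℤ/2`-modules (the shape of Hatcher's Thm. 3.26(a),
  `nonempty_singularHomology_top_iso`, for the closed model, chart-free);
* `eq_of_ne_zero_of_finrank_zmodTwo_eq_one` — in a `ℤ/2`-vector space of dimension `1` two
  nonzero vectors are equal;
* `NullCobordism.eq_of_ne_zero_singularCohomology_closedModel_top`,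
  `HomotopySphere.eq_of_ne_zero_singularCohomology_closedModel_top` — **two nonzero classes of
  `Hⁿ⁺¹(M̂; ℤ/2)` are equal**, for `M = c.W` any connected null-cobordism (of a homotopy sphere).

All for `c : NullCobordism (m + 1) M` (`dim W = m + 2 ≥ 2`, where collars exist) with `W`
connected; `M : Type` compact nonempty (the boundary).

## References

* M. Kervaire, J. Milnor, *Groups of homotopy spheres I*, Ann. of Math. 77 (1963), §7, p. 528,
  footnote pp. 528–529 ("a closed homology manifold"), p. 530. [KervaireMilnorAnnals1963]
* A. Hatcher, *Algebraic Topology* (2002), Prop. 2.7, Thm. 2.16, Prop. 2.22, Thm. 3.2 (p. 198),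
  §3.3 p. 235, Thm. 3.26, Thm. 3.43. [HatcherAT2002]
* E. Spanier, *Algebraic Topology* (1981), Ch. 6 §3, Cor. 8, Thm. 12. [Spanier1981]
* J. Milnor, J. Stasheff, *Characteristic classes* (1974), §18, Thm. 11.14. [MilnorStasheff1974]
* A. Kosinski, *Differential Manifolds* (1993), Ch. X, Prop. (3.1), proof of (3.3). [Kosinski1993]
-/

open scoped Manifold ContDiff Topology
open Set Function CategoryTheory CategoryTheory.Limits

noncomputable section

universe u

namespace Literature.Topology.FourManifolds

open Literature.AlgebraicTopology.SingularHomology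

/-! ### One-dimensional `ℤ/2`-vector spaces -/

/-- In a `ℤ/2`-vector space of dimension `1`, two nonzero vectors are equal (the second is a
nonzero multiple of the first, and `1` is the only nonzero scalar). [folklore] -/
theorem eq_of_ne_zero_of_finrank_zmodTwo_eq_one {V : Type u} [AddCommGroup V] [Module (ZMod 2) V]
    (h : Module.finrank (ZMod 2) V = 1) {a b : V} (ha : a ≠ 0) (hb : b ≠ 0) : a = b := by
  haveI : Fact (Nat.Prime 2) := ⟨Nat.prime_two⟩
  obtain ⟨r, hr⟩ := (finrank_eq_one_iff_of_nonzero' a ha).1 h b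
  have hr0 : r ≠ 0 := by
    rintro rfl
    exact hb (by rw [← hr, zero_smul])
  have hr1 : r = 1 := by
    fin_cases r
    · exact absurd rfl hr0
    · rfl
  rw [← hr, hr1, one_smul]

namespace NullCobordism

variable {m : ℕ} {M : Type} [TopologicalSpace M] [ChartedSpace (EuclideanSpace ℝ (Fin (m + 1))) M]
  [IsManifold (𝓡 (m + 1)) ∞ M] [Nonempty M] [CompactSpace M] (c : NullCobordism.{0} (m + 1) M)

omit [IsManifold (𝓡 (m + 1)) ∞ M] [Nonempty M] [CompactSpace M] in
/-- A connected manifold with boundary is path connected (it is locally path connected, the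
model half-space being so). [folklore] -/
theorem pathConnectedSpace_W [ConnectedSpace c.W] : PathConnectedSpace c.W := by
  haveI := ChartedSpace.locallyPathConnectedSpace (EuclideanHalfSpace (m + 1 + 1)) c.W
  exact PathConnectedSpace.of_locallyPathConnectedSpace

omit [IsManifold (𝓡 (m + 1)) ∞ M] [Nonempty M] [CompactSpace M] in
/-- **`dim_{ℤ/2} Hₘ₊₂(W, ∂W; ℤ/2) = 1` for a compact connected `(m+2)`-manifold with boundary**:
Lefschetz duality modulo `2` in bidegree `(0, m + 2)`, `H⁰(W; ℤ/2) ≅ Hₘ₊₂(W, ∂W; ℤ/2)`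
(Spanier 6.3.12 / Hatcher Thm. 3.43 with p. 235), and `H⁰(W; ℤ/2) ≅ Hom(H₀(W; ℤ/2), ℤ/2) ≅ ℤ/2`
for the path-connected `W` (Hatcher Thm. 3.2, Prop. 2.7). [cite: HatcherAT2002, Thm. 3.43 with §3.3 p. 235; Thm. 3.2; Prop. 2.7] [cite: Spanier1981, Ch. 6 Sec. 3 Thm. 12] -/
theorem finrank_relativeSingularHomology_top_zmodTwo [ConnectedSpace c.W] :
    Module.finrank (ZMod 2)
      (relativeSingularHomology (ZMod 2) (ZMod 2) c.W ((𝓡∂ (m + 1 + 1)).boundary c.W) (m + 1 + 1)) = 1 := by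
  haveI : Fact (Nat.Prime 2) := ⟨Nat.prime_two⟩
  haveI : PathConnectedSpace c.W := c.pathConnectedSpace_W
  have h0 : 0 + (m + 1 + 1) = m + 1 + 1 := zero_add _
  -- Lefschetz duality mod 2, as a linear equivalence `H⁰(W; ℤ/2) ≃ Hₘ₊₂(W, ∂W; ℤ/2)`
  let L : singularCohomology (ZMod 2) (ZMod 2) c.W 0 →ₗ[ZMod 2]
      relativeSingularHomology (ZMod 2) (ZMod 2) c.W ((𝓡∂ (m + 1 + 1)).boundary c.W) (m + 1 + 1) :=
    (relCapProduct (M := ZMod 2) ((𝓡∂ (m + 1 + 1)).boundary c.W) h0).flip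
      (relFundamentalClassModTwo (m + 1) c.W)
  have hL : Function.Bijective L :=
    bijective_relCapProduct_relFundamentalClassModTwo (n := m + 1) (W := c.W) h0
  rw [← (LinearEquiv.ofBijective L hL).finrank_eq,
    finrank_singularCohomology_eq_bettiNumber_of_field (ZMod 2) c.W 0, bettiNumber,
    finrank_singularHomology_zero_of_pathConnectedSpace (ZMod 2) (ZMod 2), Module.finrank_self]

/-- **`dim_{ℤ/2} Hₘ₊₂(Ŵ; ℤ/2) = 1` for the closed model `Ŵ = W ∪ cone(∂W)` of a compact connected
manifold with nonempty boundary** — with no atlas on `Ŵ`: `Hₘ₊₂(W, ∂W) ≅ Hₘ₊₂(Ŵ, ∞)` (Hatcher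
Prop. 2.22 for the good pair `(W, ∂W)`, `isIso_map_boundaryCollapse_succ`) and
`Hₘ₊₂(Ŵ) ≅ Hₘ₊₂(Ŵ, ∞)` (exact sequence of the pair, `isIso_ofAbsolute_infty_of_le`), then
`finrank_relativeSingularHomology_top_zmodTwo`. Kervaire–Milnor's "closed homology manifold"
`W ∪ cone(bW)` (footnote pp. 528–529) thus has `ℤ/2` as its top mod-2 homology, as a closed
manifold would (Hatcher Thm. 3.26(a)). [cite: HatcherAT2002, Prop. 2.22, Thm. 2.16, Thm. 3.26(a)] [cite: KervaireMilnorAnnals1963, §7, footnote pp. 528–529] -/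
theorem finrank_singularHomology_closedModel_top_zmodTwo [ConnectedSpace c.W] :
    Module.finrank (ZMod 2)
      (singularHomology (ZMod 2) (ZMod 2) (ClosedModel (m + 1) c.W) (m + 1 + 1)) = 1 := by
  haveI := NullCobordism.isIso_map_boundaryCollapse_succ (ZMod 2) (ZMod 2) c (m + 1 + 1)
  haveI := c.isIso_ofAbsolute_infty_of_le (ZMod 2) (ZMod 2) (show 1 ≤ m + 1 by omega)
  rw [(asIso (relativeSingularHomology.ofAbsolute (ZMod 2) (ZMod 2) (ClosedModel (m + 1) c.W)
      {ClosedModel.infty} (m + 1 + 1))).toLinearEquiv.finrank_eq,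
    ← (asIso (relativeSingularHomology.map (ZMod 2) (ZMod 2) (boundaryCollapse (m + 1) c.W)
      (mapsTo_boundaryCollapse (m + 1) c.W) (m + 1 + 1))).toLinearEquiv.finrank_eq]
  exact c.finrank_relativeSingularHomology_top_zmodTwo

/-- **`dim_{ℤ/2} Hᵐ⁺²(Ŵ; ℤ/2) = 1`** for the closed model of a compact connected manifold with
nonempty boundary: universal coefficients over the field `ℤ/2` (Hatcher Thm. 3.2 with p. 198,
`finrank_singularCohomology_eq_bettiNumber_of_field`) and
`finrank_singularHomology_closedModel_top_zmodTwo`. [cite: HatcherAT2002, Thm. 3.2 (p. 198), Prop. 2.22] -/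
theorem finrank_singularCohomology_closedModel_top_zmodTwo [ConnectedSpace c.W] :
    Module.finrank (ZMod 2)
      (singularCohomology (ZMod 2) (ZMod 2) (ClosedModel (m + 1) c.W) (m + 1 + 1)) = 1 := by
  haveI : Fact (Nat.Prime 2) := ⟨Nat.prime_two⟩
  rw [finrank_singularCohomology_eq_bettiNumber_of_field (ZMod 2) (ClosedModel (m + 1) c.W)
    (m + 1 + 1)]
  exact c.finrank_singularHomology_closedModel_top_zmodTwo

/-- **`Hₘ₊₂(Ŵ; ℤ/2) ≅ ℤ/2`** for the closed model of a compact connected manifold with nonempty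
boundary — the statement of Hatcher's Thm. 3.26(a) (`nonempty_singularHomology_top_iso`, there
for closed connected manifolds with an atlas) for Kervaire–Milnor's closed homology manifold
`W ∪ cone(bW)`, obtained without an atlas on it. [cite: HatcherAT2002, Thm. 3.26(a), Prop. 2.22, Thm. 3.43] [cite: KervaireMilnorAnnals1963, §7, footnote pp. 528–529] -/
theorem nonempty_singularHomology_closedModel_top_iso_zmodTwo [ConnectedSpace c.W] :
    Nonempty (singularHomology (ZMod 2) (ZMod 2) (ClosedModel (m + 1) c.W) (m + 1 + 1) ≅
      ModuleCat.of (ZMod 2) (ULift.{0} (ZMod 2))) := by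
  haveI : Fact (Nat.Prime 2) := ⟨Nat.prime_two⟩
  have h1 := c.finrank_singularHomology_closedModel_top_zmodTwo
  haveI : Module.Finite (ZMod 2)
      (singularHomology (ZMod 2) (ZMod 2) (ClosedModel (m + 1) c.W) (m + 1 + 1)) :=
    Module.finite_of_finrank_eq_succ h1
  haveI : Module.Finite (ZMod 2) (ULift.{0} (ZMod 2)) :=
    Module.Finite.equiv (ULift.moduleEquiv (R := ZMod 2) (M := ZMod 2)).symm
  have h2 : Module.finrank (ZMod 2) (ULift.{0} (ZMod 2)) = 1 := by
    rw [finrank_ulift, Module.finrank_self]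
  exact ⟨(LinearEquiv.ofFinrankEq
    (singularHomology (ZMod 2) (ZMod 2) (ClosedModel (m + 1) c.W) (m + 1 + 1))
    (ULift.{0} (ZMod 2)) (h1.trans h2.symm)).toModuleIso⟩

/-- **Two nonzero classes of `Hᵐ⁺²(Ŵ; ℤ/2)` are equal**, for the closed model `Ŵ` of a compact
connected manifold with nonempty boundary (`finrank_singularCohomology_closedModel_top_zmodTwo`).
This is the input "`Hⁿ⁺¹(M̂; ℤ/2)` has one nonzero element" of the Wu-class proof of the evenness
of the intersection form of a `π`-manifold bounded by a homotopy sphere (Kosinski X.3.1;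
Milnor–Stasheff §18 / Thm. 11.14), supplied here without the generalised Poincaré conjecture.
[cite: HatcherAT2002, Thm. 3.26(a), Prop. 2.22, Thm. 3.43, Thm. 3.2] [cite: Kosinski1993, Ch. X, Prop. (3.1) (p. 205) and proof of (3.3)] -/
theorem eq_of_ne_zero_singularCohomology_closedModel_top [ConnectedSpace c.W]
    {a b : singularCohomology (ZMod 2) (ZMod 2) (ClosedModel (m + 1) c.W) (m + 1 + 1)}
    (ha : a ≠ 0) (hb : b ≠ 0) : a = b :=
  eq_of_ne_zero_of_finrank_zmodTwo_eq_one c.finrank_singularCohomology_closedModel_top_zmodTwo ha hb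

end NullCobordism

namespace HomotopySphere

/-- **Two nonzero classes of `Hⁿ⁺¹(M̂; ℤ/2)` are equal** for the closed model `M̂ = M ∪ cone(bM)`
of a connected null-cobordism `M = c.W` of a homotopy `n`-sphere, `n ≥ 1` — step (4) of the
Wu-class proof of Kosinski's X.3.1 (evenness half), chart-free.
[cite: HatcherAT2002, Thm. 3.26(a), Prop. 2.22, Thm. 3.43, Thm. 3.2] [cite: KervaireMilnorAnnals1963, §7, footnote pp. 528–529] -/
theorem eq_of_ne_zero_singularCohomology_closedModel_top {n : ℕ} (hn : n ≠ 0)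
    (S : HomotopySphere n) (c : NullCobordism n S.carrier) [ConnectedSpace c.W]
    {a b : singularCohomology (ZMod 2) (ZMod 2) (ClosedModel n c.W) (n + 1)}
    (ha : a ≠ 0) (hb : b ≠ 0) : a = b := by
  obtain ⟨m, rfl⟩ := Nat.exists_eq_add_one_of_ne_zero hn
  haveI : Nonempty S.carrier := S.nonempty
  exact c.eq_of_ne_zero_singularCohomology_closedModel_top ha hb

/-- **`Hₙ₊₁(M̂; ℤ/2) ≅ ℤ/2`** for the closed model of a connected null-cobordism of a homotopy
`n`-sphere, `n ≥ 1` (Kervaire–Milnor's closed homology manifold, footnote pp. 528–529), without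
an atlas on `M̂`. [cite: HatcherAT2002, Thm. 3.26(a), Prop. 2.22, Thm. 3.43] [cite: KervaireMilnorAnnals1963, §7, footnote pp. 528–529] -/
theorem nonempty_singularHomology_closedModel_top_iso_zmodTwo {n : ℕ} (hn : n ≠ 0)
    (S : HomotopySphere n) (c : NullCobordism n S.carrier) [ConnectedSpace c.W] :
    Nonempty (singularHomology (ZMod 2) (ZMod 2) (ClosedModel n c.W) (n + 1) ≅
      ModuleCat.of (ZMod 2) (ULift.{0} (ZMod 2))) := by
  obtain ⟨m, rfl⟩ := Nat.exists_eq_add_one_of_ne_zero hn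
  haveI : Nonempty S.carrier := S.nonempty
  exact c.nonempty_singularHomology_closedModel_top_iso_zmodTwo

end HomotopySphere

end Literature.Topology.FourManifolds
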